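import Summits.CriticalPhenomena.CardyFormulaZ2.Theorems.CardyIKTransportIKMixedBoxCrossingTransportDefs
import Summits.CriticalPhenomena.CardyFormulaZ2.Theorems.CardyIKTransportIKMixedBoxCrossingStubPatternLocality
import Summits.CriticalPhenomena.CardyFormulaZ2.Theorems.CardyIKTransportIKMixedBoxCrossingDefectStubBridge
import Summits.CriticalPhenomena.CardyFormulaZ2.Theorems.CardyIKTransportIKMixedBoxCrossingDefectStubBridgeLaw
import Summits.CriticalPhenomena.CardyFormulaZ2.Theorems.CardyIKTransportIKMixedBoxCrossingTransportStubCylPlanePlanar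

/-!
# Stub `stub_cylPlane : CylPlane` (line `defect-closure-exploration`, reshape v4, crux `IKMixedBoxCrossing`,
# stmt-CriticalPhenomena-5911)

Support file (`--supports stmt-CriticalPhenomena-5911`): CYLINDER ↔ PLANE,
`cylArcs (n-1) (8n) (τOf S a (n-1)) n ≤ 4 · pTB S a b n (2n)`.

Assembly of the five helpers `…TransportStubCylPlane{Chain,Cut,Band,Geom,Planar}.lean`:
(i) a black path between the arcs `[n,3n)` and `[5n,7n)` of the slab crosses the band of rows `[3n,5n)` or the band
`[7n,8n) ∪ [0,n)` (`arcsEvent_subset`, discrete intermediate values); (ii) the slab law is rotation invariant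
(`cylProb_preimage_rot`), so `cylArcs ≤ 2 · cylProb (Band0)`; a band crossing of the slab is a bottom–top crossing of the planar
box read on the band (`band0_subset_tb`); (iii) on events of a band of `2n` rows of the cylinder of circumference `8n` the slab
law is at most twice the planar free box law (`cylProb_bandQ_le`: the cut + the `L∞` mixing of the row kernel); (iv) THIS FILE:
the planar free box probability of the bottom–top crossing IS the gauge probability `pTB S a b n (2n)` — at the origin the gauge's
box marginal has atoms `∝ wt S c` (`BridgeLawStub.gauge_atom`, from the landed `stub_bridgeLaw`), summing its coins over the fibres
of `toQ` (hon coins are never read, iso coins are the flags) gives the planar box weight `qWt` up to a constant (`fiber_sum`), the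
two crossing events read the same edges (`ofBox_tb_iff`), and `pTB S a b = pTB {x | x + a ∈ S} 0 0` (`recentre`, pattern locality).
-/

noncomputable section

namespace Summit.CriticalPhenomena.CardyFormulaZ2.Cruxes.IKMixedBoxCrossing.DefectClosureExploration

open scoped BigOperators Classical
open Finset MeasureTheory
open Literature.Probability.Percolation Literature.Probability.LatticeModels
open Summit.CriticalPhenomena.CardyFormulaZ2.Theorems.IKLinearTransport.PinnedDiagramExchange
  (Ω μIK Obs obs blackEdges tbCross faceWeight)
open Summit.CriticalPhenomena.CardyFormulaZ2.Theorems.IKLinearTransport.PinnedDiagramExchange.CouplingToLimits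
  (mk_mem_blackEdges_iff isProbabilityMeasure_μIK)
open Summit.CriticalPhenomena.CardyFormulaZ2.Cruxes.IKMixedBoxCrossing.PairedMirrorExploration (pTB)
open Summit.CriticalPhenomena.CardyFormulaZ2.Cruxes.IKMixedBoxCrossing.PairedMirrorExploration.StubPatternLocality
  (mem_openCrossing_congr recentre)
open BridgeLawStub (site site_injective site_apply_zero site_apply_one exists_site_eq wt fpar gauge_atom measurable_gaugeBox)
open BridgeOfLawStub (ofBox site_mem_ofBox_fst site_mem_ofBox_snd obs_congr)

namespace CylPlane

variable {w h : ℕ}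

/-! ## §1 From the gauge's box data to planar box configurations: the fibre sum -/

/-- Box data ↦ box configuration: keep the colours; the flag of the inner face `(j, s)` is its coin on an isotropic face
column and `true` (anti-diagonal) on a honeycomb one. -/
def toQ (τ : Fin w → Bool) (d : BoxData (w + 1) (h + 1)) : Q w h :=
  (d.1, fun p => (!τ p.1 || d.2 (p.1.castSucc, p.2.castSucc)))

/-- Coin indicator family: at the inner face `(j, s)` the indicator that the resulting flag is `q.2 (j, s)`, `1` elsewhere. -/
def coinInd (τ : Fin w → Bool) (q : Q w h) (a : Fin (w + 1) × Fin (h + 1)) (b : Bool) : ℝ :=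
  if (∀ p : Fin w × Fin h, a = (p.1.castSucc, p.2.castSucc) → (!τ p.1 || b) = q.2 p) then 1 else 0

/-- At an inner face. -/
theorem coinInd_inner (τ : Fin w → Bool) (q : Q w h) (i : Fin w) (s : Fin h) (b : Bool) :
    coinInd τ q (i.castSucc, s.castSucc) b = if (!τ i || b) = q.2 (i, s) then 1 else 0 := by
  unfold coinInd
  congr 1
  refine propext ⟨fun H => H (i, s) rfl, fun H p' hp' => ?_⟩
  simp only [Prod.mk.injEq, Fin.castSucc_inj] at hp'
  obtain rfl : p' = (i, s) := Prod.ext hp'.1.symm hp'.2.symm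
  exact H

/-- In the last cell column (no inner face). -/
theorem coinInd_last_fst (τ : Fin w → Bool) (q : Q w h) (s : Fin (h + 1)) (b : Bool) :
    coinInd τ q (Fin.last w, s) b = 1 := by
  unfold coinInd
  rw [if_pos]
  intro p hp
  exact absurd (congrArg Prod.fst hp).symm (Fin.castSucc_lt_last p.1).ne

/-- In the last row (no inner face). -/
theorem coinInd_last_snd (τ : Fin w → Bool) (q : Q w h) (i : Fin (w + 1)) (b : Bool) :
    coinInd τ q (i, Fin.last h) b = 1 := by
  unfold coinInd
  rw [if_pos]
  intro p hp
  exact absurd (congrArg Prod.snd hp).symm (Fin.castSucc_lt_last p.2).ne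

/-- The indicator that the flags of `toQ τ (c, κ)` are `q.2` is the product of the coin indicators. -/
theorem prod_coinInd (τ : Fin w → Bool) (q : Q w h) (κ : Fin (w + 1) × Fin (h + 1) → Bool) :
    ∏ a, coinInd τ q a (κ a) =
      if (fun p : Fin w × Fin h => (!τ p.1 || κ (p.1.castSucc, p.2.castSucc))) = q.2 then 1 else 0 := by
  unfold coinInd
  rw [Fintype.prod_boole]
  congr 1
  refine propext ⟨fun H => funext fun p => H _ p rfl, fun H a p hp => ?_⟩
  rw [hp]; exact congrFun H p

/-- **Fibre sum**: the total gauge weight `wt` of the box data with a given box configuration is a constant multiple of the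
planar box weight `qWt`. -/
theorem fiber_sum (S' : Set ℤ) (τ : Fin w → Bool) (hτ : ∀ j : Fin w, τ j = true ↔ ((j : ℕ) : ℤ) ∈ S') :
    ∃ C : ℝ, 0 < C ∧ ∀ q : Q w h,
      ∑ d : BoxData (w + 1) (h + 1), (if toQ τ d = q then wt S' d.1 else 0) = C * qWt τ q := by
  refine ⟨(∏ _p : Fin w × Fin h, (2 : ℝ)) * ((∏ _i : Fin w, (2 : ℝ)) * ((∏ _s : Fin h, (2 : ℝ)) * 2)),
    by positivity, fun q => ?_⟩
  -- colours are those of `q`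
  have step1 : ∑ d : BoxData (w + 1) (h + 1), (if toQ τ d = q then wt S' d.1 else 0) = wt S' q.1 *
      ∑ κ : Fin (w + 1) × Fin (h + 1) → Bool,
        (if (fun p : Fin w × Fin h => (!τ p.1 || κ (p.1.castSucc, p.2.castSucc))) = q.2 then (1 : ℝ) else 0) := by
    rw [Fintype.sum_prod_type, Finset.mul_sum, Finset.sum_eq_single_of_mem q.1 (Finset.mem_univ _)]
    · refine Finset.sum_congr rfl fun κ _ => ?_
      by_cases hk : (fun p : Fin w × Fin h => (!τ p.1 || κ (p.1.castSucc, p.2.castSucc))) = q.2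
      · have e : toQ τ (q.1, κ) = q := Prod.ext rfl hk
        rw [if_pos hk, if_pos e, mul_one]
      · rw [if_neg hk, if_neg (fun e => hk (congrArg Prod.snd e)), mul_zero]
    · intro c _ hc
      exact Finset.sum_eq_zero fun κ _ => if_neg fun e => hc (congrArg Prod.fst e)
  -- sum the coins cell by cell
  have step2 : ∑ κ : Fin (w + 1) × Fin (h + 1) → Bool,
      (if (fun p : Fin w × Fin h => (!τ p.1 || κ (p.1.castSucc, p.2.castSucc))) = q.2 then (1 : ℝ) else 0) =
      (∏ p : Fin w × Fin h, ∑ b : Bool, (if (!τ p.1 || b) = q.2 p then (1 : ℝ) else 0)) *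
        ((∏ _i : Fin w, (2 : ℝ)) * ((∏ _s : Fin h, (2 : ℝ)) * 2)) := by
    simp_rw [← prod_coinInd τ q]
    rw [← Fintype.prod_sum, Fintype.prod_prod_type, Fin.prod_univ_castSucc]
    simp_rw [Fin.prod_univ_castSucc (n := h), coinInd_inner, coinInd_last_fst, coinInd_last_snd, Fintype.sum_bool]
    rw [Finset.prod_mul_distrib, Fintype.prod_prod_type]
    norm_num
    ring
  have key : wt S' q.1 * ∏ p : Fin w × Fin h, (∑ b : Bool, if (!τ p.1 || b) = q.2 p then (1 : ℝ) else 0) =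
      (∏ _p : Fin w × Fin h, (2 : ℝ)) * qWt τ q := by
    rw [wt, qWt, ← Finset.prod_mul_distrib, ← Finset.prod_mul_distrib]
    refine Finset.prod_congr rfl fun p _ => ?_
    rw [Fintype.sum_bool, show fpar q.1 p = qpar q.1 p from rfl]
    have hp := hτ p.1
    unfold faceWeight
    by_cases hS : ((p.1 : ℕ) : ℤ) ∈ S'
    · have ht : τ p.1 = true := hp.2 hS
      simp only [hS, ht, true_and, Bool.not_true, Bool.false_or, if_true, coe_tIK]
      cases q.2 p <;> cases qpar q.1 p <;> norm_num <;> ring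
    · have ht : τ p.1 = false := by simpa [hS] using (not_congr hp)
      simp only [hS, ht, false_and, if_false, Bool.not_false, Bool.true_or]
      cases q.2 p <;> norm_num
  rw [step1, step2, ← mul_assoc, key]
  ring

/-! ## §2 The gauge probability of a bottom–top crossing as a planar box sum -/

/-- Crossings of the box `[0, W) × [0, H)` only read the anti flags of its INNER faces (and the colours). -/
theorem tb_congr_inner {W H : ℕ} {x y : Obs} (h1 : x.1 = y.1)
    (h2 : ∀ f : Site 2, 0 ≤ f 0 → f 0 + 1 < W → 0 ≤ f 1 → f 1 + 1 < H → (f ∈ x.2 ↔ f ∈ y.2)) :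
    x ∈ tbCross 0 0 W H ↔ y ∈ tbCross 0 0 W H := by
  have clause : ∀ p q : Site 2, p ∈ {v : Site 2 | 0 ≤ v 0 ∧ v 0 < 0 + W ∧ 0 ≤ v 1 ∧ v 1 < 0 + H} →
      q ∈ {v : Site 2 | 0 ≤ v 0 ∧ v 0 < 0 + W ∧ 0 ≤ v 1 ∧ v 1 < 0 + H} →
      ((p ∈ x.1 ∧ q ∈ x.1 ∧ (q = p + ![1, 0] ∨ q = p + ![0, 1] ∨ (q = p + ![1, 1] ∧ ¬ p ∈ x.2) ∨
          (q = p + ![1, -1] ∧ (p + ![0, -1]) ∈ x.2))) ↔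
        (p ∈ y.1 ∧ q ∈ y.1 ∧ (q = p + ![1, 0] ∨ q = p + ![0, 1] ∨ (q = p + ![1, 1] ∧ ¬ p ∈ y.2) ∨
          (q = p + ![1, -1] ∧ (p + ![0, -1]) ∈ y.2)))) := by
    intro p q hp hq
    simp only [Set.mem_setOf_eq, zero_add] at hp hq
    have hd1 : q = p + ![1, 1] → (p ∈ x.2 ↔ p ∈ y.2) := fun hqp => by
      subst hqp
      simp only [Pi.add_apply, Matrix.cons_val_zero, Matrix.cons_val_one] at hq
      exact h2 p hp.1 hq.2.1 hp.2.2.1 hq.2.2.2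
    have hd2 : q = p + ![1, -1] → ((p + ![0, -1]) ∈ x.2 ↔ (p + ![0, -1]) ∈ y.2) := fun hqp => by
      subst hqp
      simp only [Pi.add_apply, Matrix.cons_val_zero, Matrix.cons_val_one] at hq
      refine h2 _ ?_ ?_ ?_ ?_ <;> simp only [Pi.add_apply, Matrix.cons_val_zero, Matrix.cons_val_one] <;> omega
    rw [h1]
    exact and_congr_right' (and_congr_right' (or_congr_right (or_congr_right (or_congr
      (and_congr_right fun h => not_congr (hd1 h)) (and_congr_right hd2)))))
  have key : ∀ u ∈ {v : Site 2 | 0 ≤ v 0 ∧ v 0 < 0 + W ∧ 0 ≤ v 1 ∧ v 1 < 0 + H},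
      ∀ v ∈ {v : Site 2 | 0 ≤ v 0 ∧ v 0 < 0 + W ∧ 0 ≤ v 1 ∧ v 1 < 0 + H},
        (s(u, v) ∈ blackEdges x ↔ s(u, v) ∈ blackEdges y) := fun u hu v hv => by
    rw [mk_mem_blackEdges_iff, mk_mem_blackEdges_iff]
    exact or_congr (clause u v hu hv) (clause v u hv hu)
  exact mem_openCrossing_congr key

/-- The observables decoded from box data (`ofBox`) and those of the box configuration `toQ τ d` have the same bottom–top
crossings: same black cells, same anti flags on the inner faces. -/
theorem ofBox_tb_iff (S' : Set ℤ) (τ : Fin w → Bool) (hτ : ∀ j : Fin w, τ j = true ↔ ((j : ℕ) : ℤ) ∈ S')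
    (d : BoxData (w + 1) (h + 1)) :
    ofBox S' d ∈ tbCross 0 0 (w + 1) (h + 1) ↔ toQ τ d ∈ TBQ w h := by
  refine tb_congr_inner rfl fun f hf0 hfW hf1 hfH => ?_
  obtain ⟨p, rfl⟩ := exists_site_eq (k := w + 1) (l := h + 1) hf0 (by push_cast at hfW; omega) hf1
    (by push_cast at hfH; omega)
  rw [site_apply_zero] at hfW
  rw [site_apply_one] at hfH
  have hj : (p.1 : ℕ) < w := by push_cast at hfW; omega
  have hs : (p.2 : ℕ) < h := by push_cast at hfH; omega
  have ep : p = (((⟨p.1, hj⟩, ⟨p.2, hs⟩) : Fin w × Fin h).1.castSucc, ((⟨p.1, hj⟩, ⟨p.2, hs⟩) : Fin w × Fin h).2.castSucc) :=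
    Prod.ext (Fin.ext rfl) (Fin.ext rfl)
  rw [site_mem_ofBox_snd, ep, site_mem_obsQ_snd, site_apply_zero]
  simp only [toQ, Fin.val_castSucc, Bool.or_eq_true, Bool.not_eq_true']
  refine or_congr_left ?_
  rw [Bool.eq_false_iff, Ne, hτ]

/-- The gauge probability of the bottom–top crossing at the origin is a normalised box sum of `wt` (atoms of the gauge's box
marginal, `gauge_atom`). -/
theorem pTB_eq_boxSum (S' : Set ℤ) (w h : ℕ) (T : Finset (BoxData (w + 1) (h + 1)))
    (hT : ∀ ω, obs S' ω ∈ tbCross 0 0 (w + 1) (h + 1) ↔ gaugeBox S' (w + 1) (h + 1) ω ∈ T) :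
    pTB S' 0 0 (w + 1) (h + 1) = (∑ d ∈ T, wt S' d.1) / ∑ d : BoxData (w + 1) (h + 1), wt S' d.1 := by
  haveI := isProbabilityMeasure_μIK
  set ν := μIK.map (gaugeBox S' (w + 1) (h + 1)) with hν
  haveI : IsProbabilityMeasure ν := Measure.isProbabilityMeasure_map (measurable_gaugeBox S' _ _).aemeasurable
  obtain ⟨Kg, hKg⟩ : ∃ Kg : ℝ, ∀ d : BoxData (w + 1) (h + 1), ν.real {d} = Kg * wt S' d.1 :=
    ⟨_, fun d => by obtain ⟨c, κ⟩ := d; exact gauge_atom S' c κ⟩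
  have hsum : ∀ F : Finset (BoxData (w + 1) (h + 1)), ν.real ↑F = Kg * ∑ d ∈ F, wt S' d.1 := fun F => by
    rw [← sum_measureReal_singleton, Finset.mul_sum]
    exact Finset.sum_congr rfl fun d _ => hKg d
  have htot : Kg * ∑ d : BoxData (w + 1) (h + 1), wt S' d.1 = 1 := by
    rw [← hsum Finset.univ, Finset.coe_univ, probReal_univ]
  have hpre : obs S' ⁻¹' tbCross 0 0 (w + 1) (h + 1) = gaugeBox S' (w + 1) (h + 1) ⁻¹' ↑T := Set.ext fun ω => hT ω
  unfold pTB
  rw [hpre, ← map_measureReal_apply (measurable_gaugeBox S' _ _) MeasurableSet.of_discrete, ← hν, hsum T,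
    div_eq_mul_inv, ← eq_inv_of_mul_eq_one_left htot, mul_comm]

/-- **The planar free box probability of the bottom–top crossing IS the gauge probability** at the origin. -/
theorem qProb_TBQ_eq (S' : Set ℤ) (τ : Fin w → Bool) (hτ : ∀ j : Fin w, τ j = true ↔ ((j : ℕ) : ℤ) ∈ S') :
    qProb τ (TBQ w h) = pTB S' 0 0 (w + 1) (h + 1) := by
  obtain ⟨C, hC, hfib⟩ := fiber_sum (h := h) S' τ hτ
  rw [pTB_eq_boxSum S' w h (Finset.univ.filter fun d => toQ τ d ∈ TBQ w h) (fun ω => by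
    rw [Finset.mem_filter]
    exact ((obs_congr S' _ _ ω).2.trans (ofBox_tb_iff S' τ hτ _)).trans ⟨fun H => ⟨Finset.mem_univ _, H⟩, fun H => H.2⟩)]
  have regroup : ∀ F : Q w h → ℝ,
      ∑ d : BoxData (w + 1) (h + 1), F (toQ τ d) * wt S' d.1 = ∑ q, F q * (C * qWt τ q) := fun F => by
    simp_rw [← hfib, Finset.mul_sum]
    rw [Finset.sum_comm]
    refine Finset.sum_congr rfl fun d _ => ?_
    rw [Finset.sum_eq_single_of_mem (toQ τ d) (Finset.mem_univ _)]
    · rw [if_pos rfl]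
    · intro q _ hq; rw [if_neg (Ne.symm hq), mul_zero]
  set F : Q w h → ℝ := fun q => if q ∈ TBQ w h then 1 else 0 with hF
  have e1 : ∑ d ∈ Finset.univ.filter (fun d => toQ τ d ∈ TBQ w h), wt S' d.1 =
      ∑ d : BoxData (w + 1) (h + 1), F (toQ τ d) * wt S' d.1 := by
    rw [Finset.sum_filter]
    refine Finset.sum_congr rfl fun d _ => ?_
    simp only [hF]
    split_ifs <;> simp
  have e2 : ∑ d : BoxData (w + 1) (h + 1), wt S' d.1 =
      ∑ d : BoxData (w + 1) (h + 1), (fun _ => (1 : ℝ)) (toQ τ d) * wt S' d.1 := by simp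
  have e3 : ∑ q : Q w h, F q * (C * qWt τ q) = C * ∑ q, (if q ∈ TBQ w h then qWt τ q else 0) := by
    rw [Finset.mul_sum]
    exact Finset.sum_congr rfl fun q _ => by simp only [hF]; split_ifs <;> ring
  have e4 : ∑ q : Q w h, (fun _ => (1 : ℝ)) q * (C * qWt τ q) = C * ∑ q : Q w h, qWt τ q := by
    rw [Finset.mul_sum]; exact Finset.sum_congr rfl fun q _ => by ring
  rw [e1, e2, regroup F, regroup (fun _ => 1), e3, e4, mul_div_mul_left _ _ hC.ne']
  rfl

end CylPlane

/-! ## §3 The stub -/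

open CylPlane in
/-- **STUB `stub_cylPlane`** (= `CylPlane`, registered on stmt-CriticalPhenomena-5911, line `defect-closure-exploration`,
reshape v4): CYLINDER ↔ PLANE, `cylArcs (n-1) (8n) (τOf S a (n-1)) n ≤ 4 · pTB S a b n (2n)` — the two rotated bands
(geometry + rotation invariance), the cut with the `L∞` mixing of the row kernel (factor `2`), and the gauge bridge at the
origin recentred by pattern locality. -/
theorem stub_cylPlane : CylPlane := by
  intro S n a b L _ hn hL
  obtain ⟨w, rfl⟩ : ∃ w, n = w + 1 := ⟨n - 1, by omega⟩
  rw [Nat.add_sub_cancel]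
  set τ := τOf S a w with hτdef
  have hτ : ∀ j : Fin w, τ j = true ↔ ((j : ℕ) : ℤ) ∈ {x : ℤ | x + a ∈ S} := fun j => by
    simp only [hτdef, τOf, decide_eq_true_eq, Set.mem_setOf_eq, add_comm]
  have h1 := (cylProb_mono' τ (arcsEvent_subset (w := w) hn hL)).trans (cylProb_union_le τ _ _)
  rw [cylProb_preimage_rot, cylProb_preimage_rot] at h1
  have h2 : cylProb w L τ (Band0 w L (2 * (w + 1))) ≤
      cylProb w L τ ((bandQ L (2 * w + 1) : CylCfg w L → Q w (2 * w + 1)) ⁻¹' TBQ w (2 * w + 1)) :=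
    cylProb_mono' τ (by rw [show 2 * (w + 1) = (2 * w + 1) + 1 by ring]; exact band0_subset_tb (by omega))
  have h3 := cylProb_bandQ_le (w := w) (L := L) (h := 2 * w + 1) (d' := 6 * w + 6) (by omega) (by omega) τ
    (TBQ w (2 * w + 1))
  have h4 : qProb τ (TBQ w (2 * w + 1)) = pTB S a b (w + 1) (2 * (w + 1)) := by
    rw [(recentre S a b (w + 1) (2 * (w + 1))).2, show 2 * (w + 1) = (2 * w + 1) + 1 by ring]
    exact qProb_TBQ_eq {x : ℤ | x + a ∈ S} τ hτ
  unfold cylArcs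
  linarith

end Summit.CriticalPhenomena.CardyFormulaZ2.Cruxes.IKMixedBoxCrossing.DefectClosureExploration

end
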